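import Summits.Ventures.PercRepro.RankLevelSetRuleQTwelveCert
import Summits.Ventures.PercRepro.RankLevelSetRuleQTwelveCore
import Summits.Ventures.PercRepro.RankLevelSetRuleQConvTwentyOneBound
import Summits.Ventures.PercRepro.RankLevelSetRuleQConvNineteenBound

/-!
# PercRepro — THE FAMILY `k = 12` ON ITS WHOLE UNTRUNCATED REGIME, FOR EVERY `q` (p4, gen 25; C-044; paper
proofs/P4-CELL-THREE.md §13.5, §13.7)

**`rhat_twelve_whole (q m : ℕ) (hm : m + 11 ≤ q) : phiK (q + 12) q ≤ rhat q 12 m`** — Rule Q's equal split pays `Φ(q+12, q)` to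
EVERY member of EVERY cell `(q+12, q)` with `#P ≤ q − 11` (the whole untruncated regime `u = q − #P ≥ k − 1`), uniformly in `q`.
The same proof as RankLevelSetRuleQFiveWhole (paper §13): `(R̂ − Φ)·den = na·S(q,m) + nb` (**`rhat_twelve_key`**) with the master
sum `S` of RankLevelSetRuleQSumS, the two-sided continued-fraction bounds `C_19 ≤ S ≤ C_21` (`C_19` resp. `C_21` from the
tree or proved as a sub- or super-solution of the recurrence), and the two certificates `na·C_19 + nb ≥ 0`,
`na·C_21 + nb ≥ 0` (polynomials with non-negative coefficients in `(q−m−11, m)`).  No `sorry`; axioms standard.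
-/

namespace PercRepro

open Finset

/-- The lower certificate is non-negative for `a, b ≥ 0`. -/
lemma twelve_lower_cert_nonneg (a b : ℚ) (ha : 0 ≤ a) (hb : 0 ≤ b) :
    0 ≤ naTwelve (a + b + 11) b * cfNineteenN (a + b + 11) b + nbTwelve (a + b + 11) b * cfNineteenD (a + b + 11) b := by
  rw [twelve_lower_cert]; exact (add_nonneg (add_nonneg (add_nonneg (add_nonneg (add_nonneg (twelveLowerCert1_nonneg a b ha hb) (twelveLowerCert2_nonneg a b ha hb)) (twelveLowerCert3_nonneg a b ha hb)) (twelveLowerCert4_nonneg a b ha hb)) (twelveLowerCert5_nonneg a b ha hb)) (twelveLowerCert6_nonneg a b ha hb))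

/-- The upper certificate is non-negative for `a, b ≥ 0`. -/
lemma twelve_upper_cert_nonneg (a b : ℚ) (ha : 0 ≤ a) (hb : 0 ≤ b) :
    0 ≤ naTwelve (a + b + 11) b * cfTwentyOneN (a + b + 11) b + nbTwelve (a + b + 11) b * cfTwentyOneD (a + b + 11) b := by
  rw [twelve_upper_cert]; exact (add_nonneg (add_nonneg (add_nonneg (add_nonneg (add_nonneg (twelveUpperCert1_nonneg a b ha hb) (twelveUpperCert2_nonneg a b ha hb)) (twelveUpperCert3_nonneg a b ha hb)) (twelveUpperCert4_nonneg a b ha hb)) (twelveUpperCert5_nonneg a b ha hb)) (twelveUpperCert6_nonneg a b ha hb))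

/-- `na·C_19 + nb ≥ 0` on the untruncated regime. -/
lemma twelve_lower_nonneg (q m : ℕ) (hm : m + 11 ≤ q) :
    0 ≤ naTwelve q m * (cfNineteenN q m / cfNineteenD q m) + nbTwelve q m := by
  have hD := cfNineteenD_pos q m (by positivity) (by exact_mod_cast (show m + 1 ≤ q by omega))
  have ha : (0 : ℚ) ≤ (q : ℚ) - m - 11 := by
    have : ((m + 11 : ℕ) : ℚ) ≤ q := by exact_mod_cast hm
    push_cast at this; linarith
  have key := twelve_lower_cert_nonneg ((q : ℚ) - m - 11) m ha (by positivity)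
  rw [show (q : ℚ) - m - 11 + m + 11 = q by ring] at key
  have e : naTwelve q m * (cfNineteenN q m / cfNineteenD q m) + nbTwelve q m
      = (naTwelve q m * cfNineteenN q m + nbTwelve q m * cfNineteenD q m) / cfNineteenD q m := by
    rw [eq_div_iff hD.ne']; ring_nf; field_simp
  rw [e]
  exact div_nonneg key hD.le

/-- `na·C_21 + nb ≥ 0` on the untruncated regime. -/
lemma twelve_upper_nonneg (q m : ℕ) (hm : m + 11 ≤ q) :
    0 ≤ naTwelve q m * (cfTwentyOneN q m / cfTwentyOneD q m) + nbTwelve q m := by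
  have hD := cfTwentyOneD_pos q m (by positivity) (by exact_mod_cast (show m + 1 ≤ q by omega))
  have ha : (0 : ℚ) ≤ (q : ℚ) - m - 11 := by
    have : ((m + 11 : ℕ) : ℚ) ≤ q := by exact_mod_cast hm
    push_cast at this; linarith
  have key := twelve_upper_cert_nonneg ((q : ℚ) - m - 11) m ha (by positivity)
  rw [show (q : ℚ) - m - 11 + m + 11 = q by ring] at key
  have e : naTwelve q m * (cfTwentyOneN q m / cfTwentyOneD q m) + nbTwelve q m
      = (naTwelve q m * cfTwentyOneN q m + nbTwelve q m * cfTwentyOneD q m) / cfTwentyOneD q m := by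
    rw [eq_div_iff hD.ne']; ring_nf; field_simp
  rw [e]
  exact div_nonneg key hD.le

/-- **THE FAMILY `k = 12` ON ITS WHOLE UNTRUNCATED REGIME, FOR EVERY `q`**: `Φ(q+12, q) ≤ R̂(q, 12, m)` for every `m ≤ q − 11`. -/
theorem rhat_twelve_whole (q m : ℕ) (hm : m + 11 ≤ q) : phiK (q + 12) q ≤ rhat q 12 m := by
  have hkey := rhat_twelve_key q m hm
  have hden := denTwelve_pos q m
  have hlo := cfNineteen_le_sumS q m (by omega)
  have hhi := sumS_le_cfTwentyOne q m (by omega)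
  have hL := twelve_lower_nonneg q m hm
  have hU := twelve_upper_nonneg q m hm
  have hmain : 0 ≤ naTwelve q m * sumS q m + nbTwelve q m := by
    rcases le_total 0 (naTwelve q m) with hA | hA
    · calc (0 : ℚ) ≤ naTwelve q m * (cfNineteenN q m / cfNineteenD q m) + nbTwelve q m := hL
        _ ≤ naTwelve q m * sumS q m + nbTwelve q m := by
          gcongr
    · calc (0 : ℚ) ≤ naTwelve q m * (cfTwentyOneN q m / cfTwentyOneD q m) + nbTwelve q m := hU
        _ ≤ naTwelve q m * sumS q m + nbTwelve q m := by
          have := mul_le_mul_of_nonpos_left hhi hA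
          linarith
  rw [← sub_nonneg]
  rw [← hkey] at hmain
  exact nonneg_of_mul_nonneg_left hmain hden

/-- The matroid form: Rule Q's equal split pays `Φ(q+12,q)` to every member of every cell `(q+12, q)` with `#P ≤ q − 11`
(the whole untruncated regime of the family `k = 12`), for every `q`. -/
theorem ruleQRecv_ge_twelve_whole (q m : ℕ) (hm : m + 11 ≤ q) : phiK (q + 12) q ≤ rhat q 12 m :=
  rhat_twelve_whole q m hm

end PercRepro
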